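import Summits.AtomisticToContinuum.Crystallization.Theorems.FrustratedLawDichotomyCellRows
import Summits.AtomisticToContinuum.Crystallization.Theorems.FrustratedLawDichotomyCellMetric

/-!
# FrustratedLawDichotomy · crux `AperiodicFrustratedLawGap` (stmt-AtomisticToContinuum-27623) — CELL-SOUND X: THE GRID TOLERANCE LEMMA
(cell decomp-a2c, lens-5 g113; crit r1773 (B)(3) / r1775 (A)(2): the COVER side of the row sets of record `ratBox B`)

The rows of record are unions over the RATIONAL matrices of a cell box ((262) `…CellRows`).  The atlas cover (T4) is stated at
`τ_cov := τ_row − 3·A·η` and lands in the rational rows by ONE def-free tolerance argument: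
1. `coherentOn_mono_of_moved` / `coherentAt_mono_of_moved` — moving every template point by `≤ η` and enlarging `τ` by `η` preserves
   coherence (both clauses of `coherentOn` are monotone; no injectivity needed);
2. `exists_rat_near` — in a box `{F ∣ lo ≤ F ≤ hi}` with RATIONAL corner matrices every `F` has a rational `F' ∈ B` with `|F − F'|ᵢⱼ ≤ η`
   (density of `ℚ`, also on degenerate faces `lo = hi`);
3. `norm_posL_sub_posL_le` — `‖F v − F' v‖ ≤ 3η·‖v‖₂` (Cauchy–Schwarz); `norm_posL_one_le_of_intTemplate` — the `A` of an integer template;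
4. ★ `row_cover` / `rowHalo_cover` — `⋃_{F ∈ B} coherentAt (M.image (posL F ∘ a)) τ_cov Rc ⊆ ⋃_{F ∈ ratBox B} coherentAt (…) τ_row Rc`
   whenever `τ_cov + 3·η·A ≤ τ_row`, `‖a m‖₂ ≤ A` on `M`
   (numbers of record: τ_row = 1/1024, η = 2⁻²⁵, A ≤ 15 ⇒ τ_cov = 1/1024 − 2⁻¹⁹ = 511/524288, `tauCov_le`).

House conventions: SI units · italic scalars, bold vectors, sans-serif tensors · numbered formulae only when referenced · en-dash for
ranges · References = cited works, numbered, alphabetical · no footnotes; Remarks at section ends · British spelling, -ise · Lennard-Jones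
hyphenated; NASH capitalised as the Statement's notion · "folklore" tags standard bookkeeping; no new references are cited in this file.
-/

noncomputable section

namespace Summit.AtomisticToContinuum.Crystallization.Theorems.FrustratedLawDichotomyCellGrid

open MeasureTheory Metric Set
open scoped BigOperators
open Summit.AtomisticToContinuum.Crystallization.Theorems.ChargedEnergyGapNegative (E3)
open Summit.AtomisticToContinuum.Crystallization.Theorems.FrustratedLawDichotomyCoherentSets (coherentAt)
open Summit.AtomisticToContinuum.Crystallization.Theorems.FrustratedLawDichotomyCoherentOn (coherentOn mem_coherentOn_iff coherentAt_eq_coherentOn)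
open Summit.AtomisticToContinuum.Crystallization.Theorems.FrustratedLawDichotomyCoherentFloorHalo (haloWindow)
open Summit.AtomisticToContinuum.Crystallization.Theorems.FrustratedLawDichotomyCellRows (ratMatrices ratBox mem_ratBox)
open Summit.AtomisticToContinuum.Crystallization.Theorems.FrustratedLawDichotomyCellMetric (posL posL_apply)

variable {ι : Type*}

/-! ## §1. Coherence is monotone under small template moves -/

/-- ★ moving every template point by `≤ η` and enlarging the coherence radius by `η` preserves coherence on any window. [folklore] -/
theorem coherentOn_mono_of_moved (M : Finset ι) (p p' : ι → E3) {τ η : ℝ} (W : Set E3) (hmove : ∀ m ∈ M, dist (p m) (p' m) ≤ η) :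
    coherentOn (M.image p) τ W ⊆ coherentOn (M.image p') (τ + η) W := by
  intro μ hμ
  rw [mem_coherentOn_iff] at hμ ⊢
  have hball : ∀ m ∈ M, closedBall (p m) τ ⊆ closedBall (p' m) (τ + η) := by
    intro m hm x hx
    rw [mem_closedBall] at hx ⊢
    calc dist x (p' m) ≤ dist x (p m) + dist (p m) (p' m) := dist_triangle _ _ _
      _ ≤ τ + η := add_le_add hx (hmove m hm)
  refine ⟨?_, ?_⟩
  · intro x hx
    obtain ⟨m, hm, rfl⟩ := Finset.mem_image.mp hx
    have h1 := hμ.1 (p m) (Finset.mem_image_of_mem p hm)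
    exact fun h0 => h1 (measure_mono_null (hball m hm) h0)
  · have hsub : (⋃ x ∈ M.image p, closedBall x τ) ⊆ ⋃ x ∈ M.image p', closedBall x (τ + η) := by
      intro x hx
      obtain ⟨y, hy, hxy⟩ := Set.mem_iUnion₂.mp hx
      obtain ⟨m, hm, rfl⟩ := Finset.mem_image.mp hy
      exact Set.mem_iUnion₂.mpr ⟨p' m, Finset.mem_image_of_mem p' hm, hball m hm hxy⟩
    exact measure_mono_null (sdiff_le_sdiff_left hsub) hμ.2

/-- the ball-window case. [folklore] -/
theorem coherentAt_mono_of_moved (M : Finset ι) (p p' : ι → E3) {τ η : ℝ} (R : ℝ) (hmove : ∀ m ∈ M, dist (p m) (p' m) ≤ η) :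
    coherentAt (M.image p) τ R ⊆ coherentAt (M.image p') (τ + η) R := by
  rw [coherentAt_eq_coherentOn, coherentAt_eq_coherentOn]
  exact coherentOn_mono_of_moved M p p' _ hmove

/-! ## §2. Rational matrices are dense in a box with rational corners -/

/-- the closed matrix box with rational corner matrices. -/
def box (lo hi : Matrix (Fin 3) (Fin 3) ℚ) : Set (Matrix (Fin 3) (Fin 3) ℝ) := {F | ∀ i j, ((lo i j : ℚ) : ℝ) ≤ F i j ∧ F i j ≤ ((hi i j : ℚ) : ℝ)}

/-- one entry: a real in a closed interval with rational endpoints has a rational `η`-neighbour in the interval. [folklore] -/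
theorem exists_rat_near_entry {l u : ℚ} {x η : ℝ} (hl : (l : ℝ) ≤ x) (hu : x ≤ (u : ℝ)) (hη : 0 < η) :
    ∃ q : ℚ, (l : ℝ) ≤ q ∧ (q : ℝ) ≤ u ∧ |x - q| ≤ η := by
  by_cases hlu : l = u
  · refine ⟨l, le_rfl, by exact_mod_cast hlu.le, ?_⟩
    have : x = l := le_antisymm (hu.trans_eq (by exact_mod_cast hlu.symm)) hl
    rw [this, sub_self, abs_zero]; exact hη.le
  · have hlt : max (l : ℝ) (x - η) < min (u : ℝ) (x + η) := by
      have hlu' : (l : ℝ) < u := by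
        have : l ≤ u := by exact_mod_cast (show (l : ℝ) ≤ u from hl.trans hu)
        exact_mod_cast lt_of_le_of_ne this hlu
      rcases eq_or_lt_of_le hl with h1 | h1
      · rw [max_eq_left (by linarith), lt_min_iff]; exact ⟨hlu', by linarith⟩
      · rcases eq_or_lt_of_le hu with h2 | h2
        · rw [min_eq_left (by linarith), max_lt_iff]; exact ⟨hlu', by linarith⟩
        · rw [max_lt_iff, lt_min_iff, lt_min_iff]; exact ⟨⟨hlu', by linarith⟩, ⟨by linarith, by linarith⟩⟩
    obtain ⟨q, hq1, hq2⟩ := exists_rat_btwn hlt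
    rw [max_lt_iff] at hq1
    rw [lt_min_iff] at hq2
    exact ⟨q, hq1.1.le, hq2.1.le, abs_le.mpr ⟨by linarith [hq2.2], by linarith [hq1.2]⟩⟩

/-- ★ RATIONAL ROUNDING IN A BOX: every matrix of a box with rational corners has a rational matrix of the box within `η` entrywise.
[folklore] -/
theorem exists_rat_near {lo hi : Matrix (Fin 3) (Fin 3) ℚ} {F : Matrix (Fin 3) (Fin 3) ℝ} (hF : F ∈ box lo hi) {η : ℝ} (hη : 0 < η) :
    ∃ f : Fin 3 → Fin 3 → ℚ, (Matrix.of fun i j => ((f i j : ℚ) : ℝ)) ∈ ratBox (box lo hi) ∧ ∀ i j, |F i j - f i j| ≤ η := by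
  have h : ∀ i j, ∃ q : ℚ, ((lo i j : ℚ) : ℝ) ≤ q ∧ (q : ℝ) ≤ ((hi i j : ℚ) : ℝ) ∧ |F i j - q| ≤ η :=
    fun i j => exists_rat_near_entry (hF i j).1 (hF i j).2 hη
  choose f hf using h
  exact ⟨f, mem_ratBox f (fun i j => ⟨(hf i j).1, (hf i j).2.1⟩), fun i j => (hf i j).2.2⟩

/-! ## §3. Placement moves little under entrywise matrix rounding -/

/-- the label Euclidean norm: `‖posL 1 v‖² = Σ v_j²`. [folklore] -/
theorem norm_posL_one_sq (v : Fin 3 → ℝ) : ‖posL 1 v‖ ^ 2 = ∑ j, v j ^ 2 := by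
  rw [EuclideanSpace.norm_eq, Real.sq_sqrt (Finset.sum_nonneg fun i _ => by positivity)]
  refine Finset.sum_congr rfl fun j _ => ?_
  rw [posL_apply]; simp [Matrix.one_apply, Real.norm_eq_abs, sq_abs]

/-- the `A` of `row_cover` for an INTEGER TEMPLATE at scale `h`: `h²·|z|² ≤ A²` ⇒ `‖h z‖₂ ≤ A` (`|z|² ≤ Z` is a `decide` fact of the
K-file). [folklore] -/
theorem norm_posL_one_le_of_intTemplate (h : ℝ) (z : Fin 3 → ℤ) {Z : ℤ} {A : ℝ} (hz : ∑ i, z i ^ 2 ≤ Z) (hh : 0 ≤ h ^ 2)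
    (hA0 : 0 ≤ A) (hA : h ^ 2 * (Z : ℝ) ≤ A ^ 2) : ‖posL 1 (fun i => h * (z i : ℝ))‖ ≤ A := by
  have hz' : ((∑ i, z i ^ 2 : ℤ) : ℝ) ≤ (Z : ℝ) := by exact_mod_cast hz
  have hsq : ‖posL 1 (fun i => h * (z i : ℝ))‖ ^ 2 ≤ A ^ 2 := by
    rw [norm_posL_one_sq]
    have : ∑ j, (h * (z j : ℝ)) ^ 2 = h ^ 2 * ((∑ i, z i ^ 2 : ℤ) : ℝ) := by
      push_cast
      rw [Finset.mul_sum]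
      exact Finset.sum_congr rfl fun j _ => by ring
    rw [this]
    exact (mul_le_mul_of_nonneg_left hz' hh).trans hA
  have := abs_le_of_sq_le_sq hsq hA0
  rwa [abs_of_nonneg (norm_nonneg _)] at this

/-- ★ `‖F v − F' v‖ ≤ 3η·‖v‖₂` when `|F − F'|ᵢⱼ ≤ η` (`‖v‖₂ = ‖posL 1 v‖`; Cauchy–Schwarz per coordinate). [folklore] -/
theorem norm_posL_sub_posL_le {F F' : Matrix (Fin 3) (Fin 3) ℝ} {η : ℝ} (hFF : ∀ i j, |F i j - F' i j| ≤ η) (v : Fin 3 → ℝ) :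
    ‖posL F v - posL F' v‖ ≤ 3 * η * ‖posL 1 v‖ := by
  have hη : 0 ≤ η := (abs_nonneg _).trans (hFF 0 0)
  have hv2 : ‖posL 1 v‖ ^ 2 = ∑ j, v j ^ 2 := norm_posL_one_sq v
  -- each coordinate of the difference, squared
  have hcoord : ∀ i, (posL F v - posL F' v) i ^ 2 ≤ 3 * η ^ 2 * ‖posL 1 v‖ ^ 2 := by
    intro i
    have hi : (posL F v - posL F' v) i = ∑ j, (F i j - F' i j) * v j := by
      simp only [PiLp.sub_apply, posL_apply, ← Finset.sum_sub_distrib]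
      refine Finset.sum_congr rfl fun j _ => by ring
    have hrow : ∑ j, (F i j - F' i j) ^ 2 ≤ 3 * η ^ 2 := by
      calc ∑ j, (F i j - F' i j) ^ 2 ≤ ∑ _j : Fin 3, η ^ 2 := Finset.sum_le_sum fun j _ => by
            rw [← sq_abs]; exact pow_le_pow_left₀ (abs_nonneg _) (hFF i j) 2
        _ = 3 * η ^ 2 := by simp [Finset.sum_const]
    rw [hi, hv2]
    calc (∑ j, (F i j - F' i j) * v j) ^ 2 ≤ (∑ j, (F i j - F' i j) ^ 2) * ∑ j, v j ^ 2 := Finset.sum_mul_sq_le_sq_mul_sq _ _ _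
      _ ≤ 3 * η ^ 2 * ∑ j, v j ^ 2 := mul_le_mul_of_nonneg_right hrow (Finset.sum_nonneg fun j _ => sq_nonneg _)
  -- Euclidean norm from coordinates
  have hsq : ‖posL F v - posL F' v‖ ^ 2 ≤ (3 * η * ‖posL 1 v‖) ^ 2 := by
    rw [EuclideanSpace.norm_eq, Real.sq_sqrt (Finset.sum_nonneg fun i _ => by positivity)]
    calc ∑ i, ‖(posL F v - posL F' v) i‖ ^ 2 ≤ ∑ _i : Fin 3, 3 * η ^ 2 * ‖posL 1 v‖ ^ 2 := Finset.sum_le_sum fun i _ => by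
          rw [Real.norm_eq_abs, sq_abs]; exact hcoord i
      _ = (3 * η * ‖posL 1 v‖) ^ 2 := by simp [Finset.sum_const]; ring
  have h3 : 0 ≤ 3 * η * ‖posL 1 v‖ := by positivity
  have := abs_le_of_sq_le_sq hsq h3
  rwa [abs_of_nonneg (norm_nonneg _)] at this

/-! ## §4. ★ The cover: real-parameter rows at `τ_cov` sit inside the rational rows at `τ_row` -/

/-- ★★ **GRID TOLERANCE (class A).**  For a box with rational corners, a template `a` with `‖a m‖₂ ≤ A` on `M`, and radii with
`τ_cov + 3·η·A ≤ τ_row` for some `η > 0`: every configuration coherent at SOME real `F ∈ B` at radius `τ_cov` is coherent at a RATIONAL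
`F' ∈ B` at radius `τ_row` — the T4 cover may be stated over real cells at `τ_cov` and lands in the rows of record. [folklore] -/
theorem row_cover (lo hi : Matrix (Fin 3) (Fin 3) ℚ) (M : Finset ι) (a : ι → Fin 3 → ℝ) {τc τr η A : ℝ} (Rc : ℝ) (hη : 0 < η)
    (hA : ∀ m ∈ M, ‖posL 1 (a m)‖ ≤ A) (hτ : τc + 3 * η * A ≤ τr) :
    (⋃ F ∈ box lo hi, coherentAt (M.image fun m => posL F (a m)) τc Rc)
      ⊆ ⋃ F ∈ ratBox (box lo hi), coherentAt (M.image fun m => posL F (a m)) τr Rc := by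
  intro μ hμ
  obtain ⟨F, hF, hcoh⟩ := Set.mem_iUnion₂.mp hμ
  obtain ⟨f, hf, hFf⟩ := exists_rat_near hF hη
  refine Set.mem_iUnion₂.mpr ⟨_, hf, ?_⟩
  have hmove : ∀ m ∈ M, dist (posL F (a m)) (posL (Matrix.of fun i j => ((f i j : ℚ) : ℝ)) (a m)) ≤ τr - τc := by
    intro m hm
    rw [dist_eq_norm]
    refine (norm_posL_sub_posL_le (F' := Matrix.of fun i j => ((f i j : ℚ) : ℝ)) (fun i j => hFf i j) (a m)).trans ?_
    have := mul_le_mul_of_nonneg_left (hA m hm) (by positivity : (0 : ℝ) ≤ 3 * η)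
    linarith
  have := coherentAt_mono_of_moved M (fun m => posL F (a m)) (fun m => posL (Matrix.of fun i j => ((f i j : ℚ) : ℝ)) (a m)) Rc hmove hcoh
  simpa using this

/-- ★★ **GRID TOLERANCE (class H)** — the same for halo rows (the plane data do not depend on `F`). [folklore] -/
theorem rowHalo_cover (lo hi : Matrix (Fin 3) (Fin 3) ℚ) (M : Finset ι) (a : ι → Fin 3 → ℝ) {τc τr η A : ℝ} (n : E3) (s Rc : ℝ)
    (hη : 0 < η) (hA : ∀ m ∈ M, ‖posL 1 (a m)‖ ≤ A) (hτ : τc + 3 * η * A ≤ τr) :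
    (⋃ F ∈ box lo hi, coherentOn (M.image fun m => posL F (a m)) τc (haloWindow n s Rc))
      ⊆ ⋃ F ∈ ratBox (box lo hi), coherentOn (M.image fun m => posL F (a m)) τr (haloWindow n s Rc) := by
  intro μ hμ
  obtain ⟨F, hF, hcoh⟩ := Set.mem_iUnion₂.mp hμ
  obtain ⟨f, hf, hFf⟩ := exists_rat_near hF hη
  refine Set.mem_iUnion₂.mpr ⟨_, hf, ?_⟩
  have hmove : ∀ m ∈ M, dist (posL F (a m)) (posL (Matrix.of fun i j => ((f i j : ℚ) : ℝ)) (a m)) ≤ τr - τc := by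
    intro m hm
    rw [dist_eq_norm]
    refine (norm_posL_sub_posL_le (F' := Matrix.of fun i j => ((f i j : ℚ) : ℝ)) (fun i j => hFf i j) (a m)).trans ?_
    have := mul_le_mul_of_nonneg_left (hA m hm) (by positivity : (0 : ℝ) ≤ 3 * η)
    linarith
  have := coherentOn_mono_of_moved M (fun m => posL F (a m)) (fun m => posL (Matrix.of fun i j => ((f i j : ℚ) : ℝ)) (a m))
    (haloWindow n s Rc) hmove hcoh
  simpa using this

/-- NUMBERS OF RECORD (crit r1773 (B) / r1775 (A)): `τ_row = 1/1024`, `η = 2⁻²⁵`, `A ≤ 15` ⇒ the T4 cover radius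
`τ_cov := 1/1024 − 2⁻¹⁹ = 511/524288` satisfies `τ_cov + 3·η·A ≤ τ_row` (NB `2047/2097152 = 1/1024 − 2⁻²¹` would NOT: `32752 + 45 > 32768`
in units of `2⁻²⁵`). [folklore] -/
theorem tauCov_le : (511 / 524288 : ℝ) + 3 * (1 / 33554432) * 15 ≤ 1 / 1024 := by norm_num

end Summit.AtomisticToContinuum.Crystallization.Theorems.FrustratedLawDichotomyCellGrid

end
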